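import Summits.KontsevichZagierPeriods.KontsevichZagierPeriods.Theorems.RealOnePeriodRelations.Negative.Kit
import Literature.NumberTheory.Transcendental.KZCalculus
import Literature.NumberTheory.Transcendental.SemialgebraicMaps
import Mathlib.Analysis.SpecialFunctions.Pow.Real
import Mathlib.Analysis.SpecialFunctions.Sqrt

/-!
# `CurvePeriodsTransfer` (stmt-KontsevichZagierPeriods-11129) — negative knowledge, part 7:
# the genus-one Cauchy / M-curve relation is ONE change-of-variables instance

Support file for the crux `SymplecticScissors.CurvePeriodsTransfer` (cdisprove seat, cycle 3; work file
`Cruxes/CurvePeriodsTransfer/Disproof.lean` §9, §12.3).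

The open structural question on the consequent `RealOnePeriodRelations` is whether its GREEN generator is
load-bearing (`NoGreen`; = LevelPairing's `Dim1IsRules12`): is there a vanishing `ℤ`-combination of 1-dimensional
representations outside `closure (1a ∪ 1b ∪ 2)`? The natural candidates are the CAUCHY / M-CURVE relations
`Σᵢ εᵢ ∫_{ovalᵢ} dx/√|p| = 0` among the real ovals of a real hyperelliptic curve `y² = p(x)` bounding a half
`X⁺` of `X(ℂ) ∖ X(ℝ)` (pure R5 relations). This file settles the GENUS-ONE case NEGATIVELY (it is NOT a witness):
for the quartic `p = x(x−1)(x−3)(x−7)` the Möbius involution `M(x) = (7 − x)/(1 + x)` (translation by a real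
2-torsion point composed with the hyperelliptic involution: `M(0) = 7`, `M(1) = 3`) maps `(0,1)` onto `(3,7)` and
satisfies the exact identity `p(Mx)·(1+x)⁴ = 64·p(x)`, `M′(x) = −8/(1+x)²`, hence
`|p(Mx)|^{-1/2}·|M′(x)| = |p(x)|^{-1/2}`: the relation `∫₀¹ dx/√|p| = ∫₃⁷ dx/√|p|` is ONE instance of
`changeOfVariablesRel` (`cauchyGenusOne_mem_changeOfVariablesRel`). So the first honest test of `NoGreen` is
genus TWO (three ovals, `End(Jac) = ℤ` generically, no real algebraic correspondence in sight), as recorded in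
the work file §9. Stated on ARBITRARY representations carrying the two integrands (their existence —
integrability of the inverse square root at the four branch points — is not needed for the membership).
[Kontsevich–Zagier 2001, §1.2 rule (2); Huber–Wüstholz 2022, §13.1]
-/

noncomputable section

open Set MeasureTheory MvPolynomial
open Literature.NumberTheory.Transcendental
open Literature.ModelTheory.ExponentialFields (IsSemialgebraic)
open Summit.KontsevichZagierPeriods.SymplecticScissors.RealOnePeriodRelationsNegative (unitDom isSemialgebraic_unitDom)

namespace Summit.KontsevichZagierPeriods.SymplecticScissors.CurvePeriodsTransferNegative

/-- The M-quartic `p = x(x−1)(x−3)(x−7)` (four real branch points `0 < 1 < 3 < 7`). [folklore] -/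
def quartic (x : ℝ) : ℝ := x * (x - 1) * (x - 3) * (x - 7)

/-- The real integrand `|p(x)|^{-1/2}` of the holomorphic form `dx/y` on the ovals. [folklore] -/
def invSqrt (x : ℝ) : ℝ := (Real.sqrt |quartic x|)⁻¹

/-- The Möbius involution `M(x) = (7 − x)/(1 + x)` exchanging the branch points `0 ↔ 7`, `1 ↔ 3`. [folklore] -/
def mobFun (x : ℝ) : ℝ := (7 - x) / (1 + x)

/-- `M` on `ℝ¹`. [folklore] -/
def mob (z : Fin 1 → ℝ) : Fin 1 → ℝ := fun _ => mobFun (z 0)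

/-- The target oval `(3,7)` as a domain in `ℝ¹`. [folklore] -/
def dom37 : Set (Fin 1 → ℝ) := {z | z 0 ∈ Ioo 3 7}

/-- **The exact identity behind the 2-torsion translation**: `p(Mx)·(1+x)⁴ = 64·p(x)`. [folklore] -/
theorem quartic_mobFun (x : ℝ) (hx : 1 + x ≠ 0) : quartic (mobFun x) = 64 * quartic x / (1 + x) ^ 4 := by
  unfold quartic mobFun
  field_simp
  ring

/-- `M` is differentiable off `x = −1` with `M′(x) = −8/(1+x)²`. [folklore] -/
theorem hasDerivAt_mobFun (x : ℝ) (hx : 1 + x ≠ 0) : HasDerivAt mobFun (-8 / (1 + x) ^ 2) x := by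
  have h1 : HasDerivAt (fun y : ℝ => 7 - y) (-1) x := by
    simpa using (hasDerivAt_id x).const_sub 7
  have h2 : HasDerivAt (fun y : ℝ => 1 + y) 1 x := by
    simpa using (hasDerivAt_id x).const_add 1
  have h := h1.div h2 hx
  have he : (-1 * (1 + x) - (7 - x) * 1) / (1 + x) ^ 2 = -8 / (1 + x) ^ 2 := by ring
  rw [he] at h
  exact h

/-- The derivative of `mob` at `z`: `M′(z₀) • id` on `ℝ¹`. [folklore] -/
def mobDeriv (z : Fin 1 → ℝ) : (Fin 1 → ℝ) →L[ℝ] (Fin 1 → ℝ) :=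
  (-8 / (1 + z 0) ^ 2) • ContinuousLinearMap.id ℝ (Fin 1 → ℝ)

/-- `mob` has derivative `mobDeriv z` at every `z` with `1 + z₀ ≠ 0`. [folklore] -/
theorem hasFDerivAt_mob (z : Fin 1 → ℝ) (hz : 1 + z 0 ≠ 0) : HasFDerivAt mob (mobDeriv z) z := by
  have h0 : HasFDerivAt (fun w : Fin 1 → ℝ => w 0)
      (ContinuousLinearMap.proj (R := ℝ) (φ := fun _ : Fin 1 => ℝ) 0) z := hasFDerivAt_apply 0 z
  have hc : HasFDerivAt (mobFun ∘ fun w : Fin 1 → ℝ => w 0)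
      ((-8 / (1 + z 0) ^ 2) • ContinuousLinearMap.proj (R := ℝ) (φ := fun _ : Fin 1 => ℝ) 0) z :=
    HasDerivAt.comp_hasFDerivAt z (hasDerivAt_mobFun (z 0) hz) h0
  have hpi : HasFDerivAt mob (ContinuousLinearMap.pi fun _ : Fin 1 =>
      (-8 / (1 + z 0) ^ 2) • ContinuousLinearMap.proj (R := ℝ) (φ := fun _ : Fin 1 => ℝ) 0) z :=
    hasFDerivAt_pi.2 fun _ => hc
  refine hpi.congr_fderiv ?_
  ext v j
  simp [mobDeriv, Subsingleton.elim j 0]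

/-- `|det (M′(z₀) • id_{ℝ¹})| = 8/(1+z₀)²`. [folklore] -/
theorem abs_det_mobDeriv (z : Fin 1 → ℝ) : |(mobDeriv z).det| = 8 / (1 + z 0) ^ 2 := by
  have h : ((mobDeriv z : (Fin 1 → ℝ) →L[ℝ] (Fin 1 → ℝ)) : (Fin 1 → ℝ) →ₗ[ℝ] (Fin 1 → ℝ)) =
      (-8 / (1 + z 0) ^ 2) • LinearMap.id := by
    ext v j
    simp [mobDeriv]
  rw [ContinuousLinearMap.det, h, LinearMap.det_smul, LinearMap.det_id, mul_one, Module.finrank_fin_fun,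
    pow_one, abs_div, abs_neg, abs_pow, sq_abs]
  norm_num

/-- `M` maps `(0,1)` into `(3,7)`. [folklore] -/
theorem mobFun_mem {a : ℝ} (ha : a ∈ Ioo (0 : ℝ) 1) : mobFun a ∈ Ioo (3 : ℝ) 7 := by
  have h1 : 0 < 1 + a := by linarith [ha.1]
  unfold mobFun
  constructor
  · rw [lt_div_iff₀ h1]; linarith [ha.2]
  · rw [div_lt_iff₀ h1]; linarith [ha.1]

/-- `M` is an involution off `−1`: `M(M(b)) = b`. [folklore] -/
theorem mobFun_mobFun {b : ℝ} (hb : 1 + b ≠ 0) : mobFun (mobFun b) = b := by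
  unfold mobFun
  have h8 : (1 + b) + (7 - b) = 8 := by ring
  field_simp
  ring

/-- `mob '' (0,1) = (3,7)`. [folklore] -/
theorem mob_image_unitDom : mob '' unitDom = dom37 := by
  apply Subset.antisymm
  · rintro _ ⟨z, hz, rfl⟩
    exact mobFun_mem hz
  · intro w hw
    have hw' : w 0 ∈ Ioo (3 : ℝ) 7 := hw
    have h1 : 0 < 1 + w 0 := by linarith [hw'.1]
    refine ⟨fun _ => mobFun (w 0), ?_, ?_⟩
    · show mobFun (w 0) ∈ Ioo (0 : ℝ) 1
      unfold mobFun
      constructor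
      · exact div_pos (by linarith [hw'.2]) h1
      · rw [div_lt_iff₀ h1]; linarith [hw'.1]
    · funext j
      rw [Subsingleton.elim j 0]
      show mobFun (mobFun (w 0)) = w 0
      exact mobFun_mobFun h1.ne'

/-- `mob` is injective on `(0,1)`. [folklore] -/
theorem injOn_mob : InjOn mob unitDom := by
  intro z hz w hw h
  have hz1 : 0 < 1 + z 0 := by linarith [hz.1]
  have hw1 : 0 < 1 + w 0 := by linarith [hw.1]
  have h0 : mobFun (z 0) = mobFun (w 0) := congrFun h 0
  have h1 : mobFun (mobFun (z 0)) = mobFun (mobFun (w 0)) := by rw [h0]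
  rw [mobFun_mobFun hz1.ne', mobFun_mobFun hw1.ne'] at h1
  funext j
  rw [Subsingleton.elim j 0]
  exact h1

/-- `mob` is a `ℚ`-semialgebraic map on `(0,1)` (a quotient of polynomials over `ℚ`). [folklore] -/
theorem isSemialgebraicMapOn_mob : IsSemialgebraicMapOn ℚ unitDom mob := by
  refine IsSemialgebraicMapOn.of_forall isSemialgebraic_unitDom fun j => ?_
  have hq : ∀ x ∈ unitDom, aeval x (1 + X 0 : MvPolynomial (Fin 1) ℚ) ≠ 0 := by
    intro x hx
    have : 0 < 1 + x 0 := by linarith [hx.1]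
    simpa using this.ne'
  refine (isSemialgebraicFunOn_aeval_div_aeval isSemialgebraic_unitDom (7 - X 0 : MvPolynomial (Fin 1) ℚ)
    (1 + X 0) hq).congr fun x _ => ?_
  simp [mob, mobFun]

/-- The quartic does not vanish on `(0,1)`. [folklore] -/
theorem quartic_ne_zero {a : ℝ} (ha : a ∈ Ioo (0 : ℝ) 1) : quartic a ≠ 0 := by
  unfold quartic
  have h0 : a ≠ 0 := ha.1.ne'
  have h1 : a - 1 ≠ 0 := by linarith [ha.2]
  have h3 : a - 3 ≠ 0 := by linarith [ha.2]
  have h7 : a - 7 ≠ 0 := by linarith [ha.2]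
  exact mul_ne_zero (mul_ne_zero (mul_ne_zero h0 h1) h3) h7

/-- **The pointwise rule-2 identity** `|p(x)|^{-1/2} = |p(Mx)|^{-1/2} · |M′(x)|` on `(0,1)`. [folklore] -/
theorem invSqrt_eq (a : ℝ) (ha : a ∈ Ioo (0 : ℝ) 1) : invSqrt a = invSqrt (mobFun a) * (8 / (1 + a) ^ 2) := by
  have h1 : 0 < 1 + a := by linarith [ha.1]
  have hq := quartic_ne_zero ha
  unfold invSqrt
  rw [quartic_mobFun a h1.ne']
  have habs : |64 * quartic a / (1 + a) ^ 4| = 64 * |quartic a| / ((1 + a) ^ 2) ^ 2 := by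
    rw [abs_div, abs_mul, abs_of_pos (by norm_num : (0:ℝ) < 64), abs_of_pos (pow_pos h1 4)]
    ring
  have h64 : Real.sqrt 64 = 8 := by
    rw [show (64:ℝ) = 8 ^ 2 by norm_num]
    exact Real.sqrt_sq (by norm_num)
  have hsq : Real.sqrt (64 * |quartic a| / ((1 + a) ^ 2) ^ 2) = 8 * Real.sqrt |quartic a| / (1 + a) ^ 2 := by
    rw [Real.sqrt_div' _ (sq_nonneg _), Real.sqrt_sq (sq_nonneg _), Real.sqrt_mul (by norm_num : (0:ℝ) ≤ 64),
      h64]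
  have hS : Real.sqrt |quartic a| ≠ 0 := Real.sqrt_ne_zero'.mpr (abs_pos.mpr hq)
  rw [habs, hsq]
  field_simp

/-- **The genus-one Cauchy / M-curve relation is ONE change-of-variables instance**: for any representations
`r` on `(0,1)` and `r′` on `(3,7)` with integrand `|x(x−1)(x−3)(x−7)|^{-1/2}`, `[r] − [r′] ∈ changeOfVariablesRel`
(`Φ = M`, `|det Φ′| = 8/(1+x)²`). Hence the genus-one relation is no witness for `NoGreen`; the first honest test is
genus two. [cite: KontsevichZagier2001, §1.2 rule (2)] -/
theorem cauchyGenusOne_mem_changeOfVariablesRel (r r' : KZ.IntegralRep 1)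
    (hd : r.domain = unitDom) (hd' : r'.domain = dom37)
    (hi : ∀ z ∈ r.domain, r.integrand z = invSqrt (z 0))
    (hi' : ∀ z ∈ r'.domain, r'.integrand z = invSqrt (z 0)) :
    KZ.of r - KZ.of r' ∈ KZ.changeOfVariablesRel := by
  refine ⟨1, r, r', mob, mobDeriv, hd ▸ isSemialgebraicMapOn_mob, fun z hz => ?_, hd ▸ injOn_mob, ?_, fun z hz => ?_, rfl⟩
  · have hz' : z ∈ unitDom := hd ▸ hz
    have h1 : 0 < 1 + z 0 := by linarith [hz'.1]
    exact (hasFDerivAt_mob z h1.ne').hasFDerivWithinAt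
  · rw [hd', hd, mob_image_unitDom]
  · have hz' : z ∈ unitDom := hd ▸ hz
    have hmz : mob z ∈ r'.domain := by
      rw [hd', ← mob_image_unitDom]; exact ⟨z, hz', rfl⟩
    rw [hi z hz, hi' (mob z) hmz, abs_det_mobDeriv]
    exact invSqrt_eq (z 0) hz'

end Summit.KontsevichZagierPeriods.SymplecticScissors.CurvePeriodsTransferNegative

end
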